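import Summits.KontsevichZagierPeriods.KontsevichZagierPeriods.Theorems.HermiteRigidityReductionRigidityOfKernelForm
import Summits.KontsevichZagierPeriods.KontsevichZagierPeriods.Theorems.FurushoPentagonSectorToKernelOfLeaves

/-!
# KontsevichZagierPeriods / HermiteRigidity — `ReductionRigidityOfCubes` (stmt-KontsevichZagierPeriods-18142)

Route `KontsevichZagierPeriods/HermiteRigidity`, support item stmt-KontsevichZagierPeriods-18142
(`ReductionRigidityOfCubes`, rank 9), the SPLIT GLUE of the route's rank-0 target `ReductionRigidity`
along Ayoub's compact presentation (crux-strategist re-audit r1 of stmt-KontsevichZagierPeriods-3407):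

  `CubeResolution → AyoubEffectiveCubeKernel → ReductionRigidity`.

* `CubeResolution` (X₁, geometry inside the rules): every integral representation is congruent modulo
  `KZ.relations` to a `ℤ`-combination of tame cube classes `[[0,1]ⁿ, f]`, `f` real analytic on a
  neighbourhood of the closed cube.  Written import-free in the route file; since
  `{x | ∀ i, 0 ≤ x i ∧ x i ≤ 1} = ReducedPeriodRing.unitCube n` and the generated subgroup is
  `ReducedPeriodRing.cubicalSpan` by definition, it is definitionally the hypothesis `h1` of the landed
  composition `kzKernel_of_cubeResolution_of_ayoubKernel`
  (`Theorems/FurushoPentagonSectorToKernelOfLeaves.lean`).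
* `AyoubEffectiveCubeKernel` (X₂, transcendence in Ayoub's algebra; J. Ayoub, Ann. of Math. 181 (2015)
  Conj. 1.1 at `k = ℚ`): the kernel of `∫_{[0,1]^∞}` on `𝒪_{ℚ-alg}(𝔻̄^∞)` is the `ℚ`-span of the
  type-(a) elements; literally the hypothesis `h6` of the same composition.

Proof.  The landed composition `kzKernel_of_cubeResolution_of_ayoubKernel` runs the seam — resolve into
the tame cubical span (X₁), merge to one tame class (`stub_cubeMerge`), make it Ayoub-admissible inside
the moves (`stub_admissibleOfTame`), `∫ = 0` by soundness (`KZ.relations_le_ker_eval_holds`), real Stokes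
form from X₂ (`stub_realStokesForm`), `ℚ`-semialgebraicity of the primitives
(`stub_semialgebraicOfAlgebraic`), padding + calibration (`stub_stokesSpanCalibration`) — and yields the
KERNEL FORM of Conjecture 1, `∀ c, KZ.eval c = 0 → c ∈ KZ.relations`; the landed route glue
`reductionRigidityOfKernelForm_proof` (stmt-KontsevichZagierPeriods-14406,
`Theorems/HermiteRigidityReductionRigidityOfKernelForm.lean`) turns the kernel form into
REDUCTION + RIGIDITY.
-- adapted from Cruxes/ReductionRigidity/SplitR1Glue.lean (`ReductionRigidity_of_cubes`, planner-cstrat-stmt-KontsevichZagierPeriods-3407-r1-0)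

References: M. Kontsevich, D. Zagier, *Periods* (2001), §1.2; J. Ayoub, Ann. of Math. 181 (2015),
Conj. 1.1, Rem. 1.2; J. Ayoub, EMS Newsl. 91 (2014), Def. 9–10, Prop. 11, Rem. 12–13; A. Huber,
S. Müller-Stach, *Periods and Nori Motives* (2017), §12.2, §13.1.
-/

namespace Summit.KontsevichZagierPeriods.HermiteRigidity.ReductionRigidityOfCubes

open Literature.NumberTheory.Transcendental
open Summit.KontsevichZagierPeriods.FurushoPentagon.SectorToKernel
  (kzKernel_of_cubeResolution_of_ayoubKernel)
open Summit.KontsevichZagierPeriods.HermiteRigidity.ReductionRigidityOfKernelForm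
  (reductionRigidityOfKernelForm_proof)

/-- **The kernel form of Conjecture 1 from the two children of the split**, `CubeResolution` and
`AyoubEffectiveCubeKernel` (both unfolded): every formal `ℤ`-combination of integral representations
of value `0` lies in `KZ.relations`.  The import-free cube `{x | ∀ i, 0 ≤ x i ∧ x i ≤ 1}` of the route
file is `ReducedPeriodRing.unitCube n` and the generated subgroup is `ReducedPeriodRing.cubicalSpan`,
definitionally, so `CubeResolution` is repackaged as the cubical resolution hypothesis of the landed
composition `kzKernel_of_cubeResolution_of_ayoubKernel` (steps (1)–(7) of the seam).
[Ayoub 2015, Conj. 1.1; Ayoub 2014, Rem. 12–13; Kontsevich–Zagier 2001, §1.2] -/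
theorem kernelForm_of_cubes
    (h1 : Summit.KontsevichZagierPeriods.KontsevichZagierPeriods.Theses.HermiteRigidity.CubeResolution)
    (h6 : Summit.KontsevichZagierPeriods.KontsevichZagierPeriods.Theses.HermiteRigidity.AyoubEffectiveCubeKernel) :
    ∀ c : KZ.FormalRep, KZ.eval c = 0 → c ∈ KZ.relations := by
  unfold Summit.KontsevichZagierPeriods.KontsevichZagierPeriods.Theses.HermiteRigidity.CubeResolution at h1
  unfold Summit.KontsevichZagierPeriods.KontsevichZagierPeriods.Theses.HermiteRigidity.AyoubEffectiveCubeKernel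
    at h6
  refine kzKernel_of_cubeResolution_of_ayoubKernel (fun N u => ?_) h6
  obtain ⟨c, hc, huc⟩ := h1 N u
  exact ⟨c, hc, huc⟩

/-- **`ReductionRigidityOfCubes`** (item stmt-KontsevichZagierPeriods-18142 of route HermiteRigidity):
`CubeResolution → AyoubEffectiveCubeKernel → ReductionRigidity`.  The two children give the kernel
form of Conjecture 1 (`kernelForm_of_cubes`), and `reductionRigidityOfKernelForm_proof`
(stmt-KontsevichZagierPeriods-14406) turns the kernel form into REDUCTION + RIGIDITY.
[Kontsevich–Zagier 2001, §1.2] [Ayoub 2015, Conj. 1.1] [Huber–Müller-Stach 2017, §13.1] -/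
theorem reductionRigidityOfCubes_proof :
    Summit.KontsevichZagierPeriods.KontsevichZagierPeriods.Theses.HermiteRigidity.ReductionRigidityOfCubes := by
  unfold Summit.KontsevichZagierPeriods.KontsevichZagierPeriods.Theses.HermiteRigidity.ReductionRigidityOfCubes
  intro h1 h6
  exact reductionRigidityOfKernelForm_proof (kernelForm_of_cubes h1 h6)

end Summit.KontsevichZagierPeriods.HermiteRigidity.ReductionRigidityOfCubes
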